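import Summits.ResolutionOfSingularities.ResolutionOfSingularities.Theorems.FrobeniusLadderFInjectiveMacaulayficationStrictTransformChartSub
import Summits.ResolutionOfSingularities.ResolutionOfSingularities.Theorems.FrobeniusLadderFInjectiveMacaulayficationAffineBlowupStalkClause
import Summits.ResolutionOfSingularities.ResolutionOfSingularities.Theorems.FrobeniusLadderFInjectiveMacaulayficationE8Char5FiModel
import Summits.ResolutionOfSingularities.ResolutionOfSingularities.Theorems.FrobeniusLadderFInjectiveMacaulayficationPrimeTransfer
import Summits.ResolutionOfSingularities.ResolutionOfSingularities.Theorems.FrobeniusLadderFInjectiveMacaulayficationFTemkinClosedPoints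
import Literature.AlgebraicGeometry.Resolution.AffineBlowupIntegral
import HarnessLib

/-!
# ENGINE: every blowing up of a hypersurface `Spec k[X]/(f)` along a COORDINATE SUB-CENTRE `(x̄_j : j ∈ Λ)` is FULL at every point, from chart clauses
# (crux `FInjectiveMacaulayfication` stmt-ResolutionOfSingularities-15315, chain w45a; distilled from this seat's (O-3) `…LoopGermLCureAll` / NEG-N floor files so that
# the next cure along a coordinate subspace (v44 «SING TOWERS», (Q3) p = 3 rows, further loop germs) is ONE application; seat res-L1-w45a-stub-3 g10)

[OURS · L1 W4.5a] Support file (`--supports stmt-ResolutionOfSingularities-15315 --as helper`); unconditional; def-free; GENERIC in the prime `p`, the number of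
variables `n`, the hypersurface `f` and the sub-centre `Λ`; replaces the role of NO printed item; NOT a statement of the manuscript; AI-written (AI review is weaker than
expert review).

INPUT (all elementary for a concrete `f`): `f` prime; `Λ ≠ ∅`; for each `i ∈ Λ` the strict transform `g i` under `θ_{Λ,i} : X_j ↦ X_j X_i (j ∈ Λ ∖ i)` with
`θ_{Λ,i} f = X_i^{μ i} · g i` (`ring`), `(g i)` prime, `X_i ∉ (g i)`, `f ∉ (X_i)`; the CM + Frobenius-closed clause at EVERY maximal ideal of `k[X]/(g i)` (Fedder cells);
and FULL at the primes of `k[X]/(f)` NOT containing the centre (off-cells / regularity). OUTPUT ★★★ `isBlowup_fullCl_of_subCentre`: for EVERY `π : S″ ⟶ Spec k[X]/(f)` with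
`IsBlowup π (x̄_j : j ∈ Λ)~`, EVERY stalk of `S″` is `FullCl p`. Route: res-L1-w45a-lead-1's ✓ p643799 `StrictTransformChartSub.strictTransformChartSub` (chart rings),
`E8Char5FiModel.clause_maximal_of_ringEquiv` (transport), res's E6″ `AffineBlowupStalkClause.stub_affineBlowupStalkClause` (stalks of the model), `affineBlowup.isIntegral` +
`IsBlowup.unique` + `FTemkinClosedPoints.fullCl_of_isIso_stalkMap'` (any blowing up). Also ★ `affineBlowup_fullCl_of_subCentre` (the model) and `centre_ne_bot`.
[folklore assembly; cite: StacksProject, Tag 0804 and Tag 080E; GortzWedhorn2020, Prop. 13.91; Fedder1983, Thm. 1.12 (the shape of the clause)]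
-/

-- single-problem summit: the doubled namespace component is forced
set_option linter.dupNamespace false

noncomputable section

open AlgebraicGeometry CategoryTheory Literature.AlgebraicGeometry.Resolution TopologicalSpace IsLocalRing MvPolynomial

namespace Summit.ResolutionOfSingularities.ResolutionOfSingularities.Theorems.FInjectiveMacaulayfication.SubCentreBlowupFull

open Summit.ResolutionOfSingularities.ResolutionOfSingularities.Theorems.FInjectiveMacaulayfication
open SliceableCentre

variable (p : ℕ) [Fact p.Prime] (k : Type) [Field k] [CharP k p] {n : ℕ}

/-- The coordinate sub-centre `(x̄_j : j ∈ Λ)` of the domain `k[X]/(f)` is nonzero as soon as `Λ ≠ ∅` and `f ∉ (X_i)` for some `i ∈ Λ`. [plumbing] -/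
theorem centre_ne_bot (f : MvPolynomial (Fin n) k) (hf : (Ideal.span {f}).IsPrime) (Λ : Finset (Fin n)) {i : Fin n} (hi : i ∈ Λ)
    (hfX : f ∉ Ideal.span {(X i : MvPolynomial (Fin n) k)}) :
    Ideal.span ((fun j : Fin n => Ideal.Quotient.mk (Ideal.span {f}) (X j)) '' (Λ : Set (Fin n))) ≠ ⊥ := fun hbot =>
  PrimeTransfer.X_not_mem_span_of_isPrime hf hfX
    (Ideal.Quotient.eq_zero_iff_mem.mp ((Submodule.eq_bot_iff _).mp hbot _ (StrictTransformChartSub.mem_centre _ Λ hi)))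

set_option maxHeartbeats 1600000 in
-- E6″ over an enumeration of the sub-centre + one strict-transform identification and one clause transport per chart
/-- ★ **THE MODEL**: every stalk of `affineBlowup (x̄_j : j ∈ Λ)` over `Spec k[X]/(f)` is `FullCl p`, given the chart clauses and FULL off the centre.
[folklore assembly; cite: StacksProject, Tag 0804] -/
theorem affineBlowup_fullCl_of_subCentre (f : MvPolynomial (Fin n) k) (hf : Prime f) (Λ : Finset (Fin n)) (hΛ : Λ.Nonempty)
    (μ : Fin n → ℕ) (g : Fin n → MvPolynomial (Fin n) k)
    (hθ : ∀ i ∈ Λ, aeval (fun j : Fin n => if j ∈ Λ ∧ j ≠ i then X j * X i else (X j : MvPolynomial (Fin n) k)) f = X i ^ μ i * g i)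
    (hgp : ∀ i ∈ Λ, (Ideal.span {g i}).IsPrime) (hXg : ∀ i ∈ Λ, (X i : MvPolynomial (Fin n) k) ∉ Ideal.span {g i})
    (hfX : ∀ i ∈ Λ, f ∉ Ideal.span {(X i : MvPolynomial (Fin n) k)})
    (hcl : ∀ i ∈ Λ, ∀ (Q' : Ideal (MvPolynomial (Fin n) k ⧸ Ideal.span {g i})) [Q'.IsMaximal],
      ∀ d : ℕ, ringKrullDim (Localization.AtPrime Q') = d → ∀ s : Fin d → Localization.AtPrime Q',
        (Ideal.span (Set.range s)).radical.IsMaximal →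
          RingTheory.Sequence.IsWeaklyRegular (Localization.AtPrime Q') (List.ofFn s) ∧
          ∀ y : Localization.AtPrime Q', (∃ e : ℕ, y ^ p ^ e ∈ Ideal.span
            ((fun z : Localization.AtPrime Q' => z ^ p ^ e) '' (Ideal.span (Set.range s) : Set (Localization.AtPrime Q')))) → y ∈ Ideal.span (Set.range s))
    (hoff : ∀ (P : Ideal (MvPolynomial (Fin n) k ⧸ Ideal.span {f})) [P.IsPrime], ¬ Ideal.span ((fun j : Fin n => Ideal.Quotient.mk (Ideal.span {f}) (X j)) '' (Λ : Set (Fin n))) ≤ P → FullCl p (Localization.AtPrime P)) :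
    ∀ y : ↥(affineBlowup (Ideal.span ((fun j : Fin n => Ideal.Quotient.mk (Ideal.span {f}) (X j)) '' (Λ : Set (Fin n))))), FullCl p ((affineBlowup (Ideal.span ((fun j : Fin n => Ideal.Quotient.mk (Ideal.span {f}) (X j)) '' (Λ : Set (Fin n))))).presheaf.stalk y) := by
  classical
  have hfprime : (Ideal.span {f}).IsPrime := (Ideal.span_singleton_prime hf.ne_zero).mpr hf
  haveI := hfprime
  haveI : IsDomain (MvPolynomial (Fin n) k ⧸ Ideal.span {f}) := Ideal.Quotient.isDomain _
  haveI : CharP (MvPolynomial (Fin n) k ⧸ Ideal.span {f}) p := charP_of_injective_algebraMap (algebraMap k _).injective p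
  -- enumerate the centre: `xΛ t = x̄_(e t)`, `e : Fin r ≃ Λ`
  set x : Fin n → MvPolynomial (Fin n) k ⧸ Ideal.span {f} := fun j => Ideal.Quotient.mk (Ideal.span {f}) (X j) with hx
  let e := Λ.equivFin.symm
  let xΛ : Fin Λ.card → MvPolynomial (Fin n) k ⧸ Ideal.span {f} := fun t => x (e t : Fin n)
  have heΛ : ∀ t, ((e t : Λ) : Fin n) ∈ Λ := fun t => (e t).2
  have hxI : ∀ t, xΛ t ∈ Ideal.span ((fun j : Fin n => Ideal.Quotient.mk (Ideal.span {f}) (X j)) '' (Λ : Set (Fin n))) := fun t => StrictTransformChartSub.mem_centre x Λ (heΛ t)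
  have hspan : Ideal.span (Set.range xΛ) = Ideal.span ((fun j : Fin n => Ideal.Quotient.mk (Ideal.span {f}) (X j)) '' (Λ : Set (Fin n))) := by
    apply le_antisymm
    · rw [Ideal.span_le]; rintro _ ⟨t, rfl⟩; exact hxI t
    · rw [Ideal.span_le]
      rintro _ ⟨j, hj, rfl⟩
      refine Ideal.subset_span ⟨Λ.equivFin ⟨j, Finset.mem_coe.mp hj⟩, ?_⟩
      show x ((e (Λ.equivFin ⟨j, _⟩) : Λ) : Fin n) = x j
      rw [show e (Λ.equivFin ⟨j, Finset.mem_coe.mp hj⟩) = ⟨j, Finset.mem_coe.mp hj⟩ from Λ.equivFin.symm_apply_apply _]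
  obtain ⟨i₀, hi₀⟩ := hΛ
  have hIne : Ideal.span ((fun j : Fin n => Ideal.Quotient.mk (Ideal.span {f}) (X j)) '' (Λ : Set (Fin n))) ≠ ⊥ := centre_ne_bot k f hfprime Λ hi₀ (hfX i₀ hi₀)
  intro y
  refine AffineBlowupStalkClause.stub_affineBlowupStalkClause p (MvPolynomial (Fin n) k ⧸ Ideal.span {f}) (Ideal.span ((fun j : Fin n => Ideal.Quotient.mk (Ideal.span {f}) (X j)) '' (Λ : Set (Fin n)))) Λ.card xΛ hxI hspan hIne
    (fun P _ hP => hoff P hP) ?_ y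
  intro t _ Q _ _
  -- the chart at `i = e t ∈ Λ`: `k[X]/(g i) ≃ (A[It])_((x̄_i t))`
  obtain ⟨e₀, -⟩ := StrictTransformChartSub.strictTransformChartSub k n f (g (e t : Fin n)) Λ (e t : Fin n) (heΛ t) (μ (e t : Fin n))
    (hgp _ (heΛ t)) (hXg _ (heΛ t)) (hθ _ (heΛ t)) x rfl
  exact E8Char5FiModel.clause_maximal_of_ringEquiv p e₀ 0 0 (map_zero _) (fun Q' _ _ => hcl _ (heΛ t) Q') Q (Ideal.zero_mem Q)

/-- ★★★ **ENGINE: EVERY BLOWING UP OF `Spec k[X]/(f)` ALONG THE COORDINATE SUB-CENTRE `(x̄_j : j ∈ Λ)` IS FULL AT EVERY POINT**, from: `f` prime, the `Λ`-charts'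
strict transforms prime with the CM + Frobenius-closed clause at every maximal ideal, and FULL off the centre. (`IsBlowup.unique` moves the model's stalks to any
blowing up.) [folklore assembly; cite: GortzWedhorn2020, Prop. 13.91; StacksProject, Tag 0804] -/
theorem isBlowup_fullCl_of_subCentre (f : MvPolynomial (Fin n) k) (hf : Prime f) (Λ : Finset (Fin n)) (hΛ : Λ.Nonempty)
    (μ : Fin n → ℕ) (g : Fin n → MvPolynomial (Fin n) k)
    (hθ : ∀ i ∈ Λ, aeval (fun j : Fin n => if j ∈ Λ ∧ j ≠ i then X j * X i else (X j : MvPolynomial (Fin n) k)) f = X i ^ μ i * g i)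
    (hgp : ∀ i ∈ Λ, (Ideal.span {g i}).IsPrime) (hXg : ∀ i ∈ Λ, (X i : MvPolynomial (Fin n) k) ∉ Ideal.span {g i})
    (hfX : ∀ i ∈ Λ, f ∉ Ideal.span {(X i : MvPolynomial (Fin n) k)})
    (hcl : ∀ i ∈ Λ, ∀ (Q' : Ideal (MvPolynomial (Fin n) k ⧸ Ideal.span {g i})) [Q'.IsMaximal],
      ∀ d : ℕ, ringKrullDim (Localization.AtPrime Q') = d → ∀ s : Fin d → Localization.AtPrime Q',
        (Ideal.span (Set.range s)).radical.IsMaximal →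
          RingTheory.Sequence.IsWeaklyRegular (Localization.AtPrime Q') (List.ofFn s) ∧
          ∀ y : Localization.AtPrime Q', (∃ e : ℕ, y ^ p ^ e ∈ Ideal.span
            ((fun z : Localization.AtPrime Q' => z ^ p ^ e) '' (Ideal.span (Set.range s) : Set (Localization.AtPrime Q')))) → y ∈ Ideal.span (Set.range s))
    (hoff : ∀ (P : Ideal (MvPolynomial (Fin n) k ⧸ Ideal.span {f})) [P.IsPrime], ¬ Ideal.span ((fun j : Fin n => Ideal.Quotient.mk (Ideal.span {f}) (X j)) '' (Λ : Set (Fin n))) ≤ P → FullCl p (Localization.AtPrime P)) :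
    ∀ (S'' : Scheme.{0}) (π : S'' ⟶ Spec (.of (MvPolynomial (Fin n) k ⧸ Ideal.span {f}))), IsBlowup π (affineBlowup.idealSheaf (Ideal.span ((fun j : Fin n => Ideal.Quotient.mk (Ideal.span {f}) (X j)) '' (Λ : Set (Fin n))))) →
      ∀ s : S'', FullCl p (S''.presheaf.stalk s) := by
  have hfprime : (Ideal.span {f}).IsPrime := (Ideal.span_singleton_prime hf.ne_zero).mpr hf
  haveI := hfprime
  haveI : IsDomain (MvPolynomial (Fin n) k ⧸ Ideal.span {f}) := Ideal.Quotient.isDomain _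
  obtain ⟨i₀, hi₀⟩ := id hΛ
  have hIne : Ideal.span ((fun j : Fin n => Ideal.Quotient.mk (Ideal.span {f}) (X j)) '' (Λ : Set (Fin n))) ≠ ⊥ := centre_ne_bot k f hfprime Λ hi₀ (hfX i₀ hi₀)
  haveI : IsIntegral (affineBlowup (Ideal.span ((fun j : Fin n => Ideal.Quotient.mk (Ideal.span {f}) (X j)) '' (Λ : Set (Fin n))))) := affineBlowup.isIntegral (R := MvPolynomial (Fin n) k ⧸ Ideal.span {f}) (I := Ideal.span ((fun j : Fin n => Ideal.Quotient.mk (Ideal.span {f}) (X j)) '' (Λ : Set (Fin n)))) hIne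
  have hmodel := affineBlowup_fullCl_of_subCentre p k f hf Λ hΛ μ g hθ hgp hXg hfX hcl hoff
  intro S'' π hπ s
  obtain ⟨e, -, -⟩ := (affineBlowup.isBlowup (Ideal.span ((fun j : Fin n => Ideal.Quotient.mk (Ideal.span {f}) (X j)) '' (Λ : Set (Fin n))))).unique hπ
  exact FTemkinClosedPoints.fullCl_of_isIso_stalkMap' p e.inv s (hmodel (e.inv.base s))

end Summit.ResolutionOfSingularities.ResolutionOfSingularities.Theorems.FInjectiveMacaulayfication.SubCentreBlowupFull

end
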